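/-
Copyright (c) 2026. All rights reserved.
Released under Apache 2.0 license as described in the file LICENSE.
Authors: abc-iut cell, seat abc-iut-w6-d067 (gen 5).
-/
import Literature.GroupTheory.ProductZModNotStronglyComplete
import Mathlib.GroupTheory.SpecificGroups.Cyclic
import HarnessLib

/-!
# A compact group with infinitely many characters to `ℤ/p` maps onto `(ℤ/p)^ℕ`, hence is not
# strongly complete

A profinite group is *strongly complete* when every subgroup of finite index is open
(L. Ribes, P. Zalesskii, *Profinite Groups*, §4.2; the property is spelled out, no definition is
introduced).  Nikolov–Segal prove strong completeness for topologically finitely generated profinite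
groups (named fact `Literature.GroupTheory.NikolovSegalStatement`); Serre's pro-`p` case is PROVED in
`Literature/GroupTheory/ProPStronglyComplete.lean`; `ProductZModNotStronglyComplete.lean`
(abc-iut-w5-d116) shows that `(ℤ/p)^ℕ` is NOT strongly complete and that strong completeness
DESCENDS along continuous surjections from compact groups (`exists_finiteIndex_not_isOpen_of_surjective`),
remarking that «any profinite group with `(ℤ/p)^ℕ` as a continuous quotient — e.g. a free pro-`p` group
of infinite rank — is not strongly complete; the surjection itself is print, not typed».

This proof-only file (0 definitions) TYPES THAT SURJECTION in the natural generality: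

* `exists_continuous_surjective_pi_zmod_of_infinite` — if a COMPACT topological group `G` has
  infinitely many homomorphisms `G →* Multiplicative (ZMod p)` with OPEN kernel (`p` prime), then there
  is a continuous SURJECTIVE homomorphism `G →* Multiplicative (ℕ → ZMod p)`.  Proof: choose characters
  `χ₀, χ₁, …` recursively so that every prefix `(χ₀, …, χₙ₋₁) : G → (ℤ/p)ⁿ` is surjective — a character
  NOT killing `K = ⋂_{i<n} ker χᵢ` exists because the characters killing `K` are determined by their
  values on a (finite) set of coset representatives, so there are only finitely many of them
  (`exists_character_apply_ne_one`), and adjoining such a character keeps the prefix map surjective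
  (`surjective_snoc_of_apply_ne_one`); the resulting map `G → (ℤ/p)^ℕ` is continuous with closed
  (compact) and dense image, hence onto;
* `exists_finiteIndex_not_isOpen_of_infinite_characters` — hence such a `G` has a finite-index
  subgroup which is NOT open (descent + the `(ℤ/p)^ℕ` witness of abc-iut-w5-d116);
* `finite_characters_of_forall_finiteIndex_isOpen` — contrapositive: a strongly complete compact
  group has only FINITELY many homomorphisms to `ℤ/p`, for every prime `p`;
* `exists_finiteIndex_not_isOpen_of_infinite_openNormal_index_eq` /
  `finite_openNormal_index_eq_of_forall_finiteIndex_isOpen` — the same in the language of open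
  normal subgroups of index `p` (for a pro-`p` group `P` these are the hyperplanes of `P/Φ(P)`, so
  «infinitely many» means «`P` is not topologically finitely generated»: the exact converse boundary
  of Serre's theorem `Literature.GroupTheory.ProP.isOpen_of_finiteIndex_of_proP`).

Classical (Ribes–Zalesskii §4.2; the observation that a non-finitely-generated pro-`p` group is not
strongly complete is standard folklore around Serre's theorem, J.-P. Serre, *Cohomologie galoisienne*
I §4.2 ex. 6).  Relation to the abc-iut FACT-LIST: row F-1977 `Rmk253.FiniteIndexOpenOfTopFG`
(Nikolov–Segal) keeps its hypothesis «topologically finitely generated» and is neither used nor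
refuted here; this file certifies the hypothesis boundary (wild inertia of a `p`-adic field, a free
pro-`p` group of countably infinite rank, is not strongly complete).  No side taken on
[IUTchIII] Cor. 3.12.

[cite: RibesZalesskii2010, §4.2] [cite: SerreGaloisCohomology1997, I §4.2 ex. 6]
-/

namespace Literature.GroupTheory

open Topology Filter

universe u

variable {G : Type u} [Group G] [TopologicalSpace G]

/-! ### Characters with open kernel are continuous -/

/-- A homomorphism into a DISCRETE group whose kernel is open is continuous (its fibres are cosets of
the kernel).  Private plumbing. [folklore] -/
private theorem continuous_of_isOpen_ker [IsTopologicalGroup G] {H : Type*} [Group H] [TopologicalSpace H]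
    [DiscreteTopology H] (χ : G →* H) (hχ : IsOpen (χ.ker : Set G)) : Continuous χ := by
  refine continuous_discrete_rng.2 fun b => ?_
  by_cases hb : b ∈ Set.range χ
  · obtain ⟨g₀, rfl⟩ := hb
    have : (χ : G → H) ⁻¹' {χ g₀} = (fun g => g₀ * g) '' (χ.ker : Set G) := by
      ext g
      simp only [Set.mem_preimage, Set.mem_singleton_iff, Set.mem_image, SetLike.mem_coe,
        MonoidHom.mem_ker]
      constructor
      · intro h
        exact ⟨g₀⁻¹ * g, by rw [map_mul, map_inv, h, inv_mul_cancel], by group⟩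
      · rintro ⟨k, hk, rfl⟩
        rw [map_mul, hk, mul_one]
    rw [this]
    exact (Homeomorph.mulLeft g₀).isOpenMap _ hχ
  · have : (χ : G → H) ⁻¹' {b} = ∅ := by
      ext g
      simp only [Set.mem_preimage, Set.mem_singleton_iff, Set.mem_empty_iff_false, iff_false]
      exact fun h => hb ⟨g, h⟩
    rw [this]
    exact isOpen_empty

/-! ### The recursion step: adjoining one more character -/

section Step

variable {p : ℕ} [Fact p.Prime]

/-- If the joint map `g ↦ (χᵢ g)ᵢ` of finitely many characters `χ : Fin n → (G →* ℤ/p)` is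
surjective and `G` has infinitely many characters with open kernel, then some character with open
kernel does NOT kill the common kernel `⋂ᵢ ker χᵢ`: the characters killing it are determined by their
values on a set of representatives (a section of the joint map), a finite amount of data.
[cite: RibesZalesskii2010, §4.2] -/
theorem exists_character_apply_ne_one {n : ℕ} (χ : Fin n → (G →* Multiplicative (ZMod p)))
    (hsurj : Function.Surjective fun g : G => fun i : Fin n => Multiplicative.toAdd (χ i g))
    (hinf : Set.Infinite {ψ : G →* Multiplicative (ZMod p) | IsOpen (ψ.ker : Set G)}) :
    ∃ ψ : G →* Multiplicative (ZMod p), IsOpen (ψ.ker : Set G) ∧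
      ∃ k : G, (∀ i, χ i k = 1) ∧ ψ k ≠ 1 := by
  classical
  obtain ⟨s, hs⟩ := hsurj.hasRightInverse
  by_contra hcon
  push Not at hcon
  apply hinf
  -- every character with open kernel kills `K = {k | ∀ i, χ i k = 1}`, hence is determined by its
  -- values on the representatives `s v`
  refine Set.Finite.of_injOn (f := fun ψ : G →* Multiplicative (ZMod p) =>
      fun v : Fin n → ZMod p => ψ (s v)) (fun _ _ => Set.mem_univ _) ?_ Set.finite_univ
  intro ψ hψ ψ' hψ' he
  refine MonoidHom.ext fun g => ?_
  -- `g = s (F g) * k` with `k ∈ K`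
  set v : Fin n → ZMod p := fun i => Multiplicative.toAdd (χ i g) with hv
  have hk : ∀ i, χ i ((s v)⁻¹ * g) = 1 := by
    intro i
    have h1 : Multiplicative.toAdd (χ i (s v)) = Multiplicative.toAdd (χ i g) := congr_fun (hs v) i
    have h2 : χ i (s v) = χ i g := Multiplicative.toAdd.injective h1
    rw [map_mul, map_inv, h2, inv_mul_cancel]
  have e : g = s v * ((s v)⁻¹ * g) := by group
  have hψk : ψ ((s v)⁻¹ * g) = 1 := hcon ψ hψ _ hk
  have hψ'k : ψ' ((s v)⁻¹ * g) = 1 := hcon ψ' hψ' _ hk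
  have hsv : ψ (s v) = ψ' (s v) := congr_fun he v
  rw [e, map_mul ψ (s v) ((s v)⁻¹ * g), map_mul ψ' (s v) ((s v)⁻¹ * g), hψk, hψ'k, hsv]

omit [TopologicalSpace G] in
/-- Adjoining to a jointly surjective tuple of characters `χ : Fin n → (G →* ℤ/p)` a character `ψ`
which is nontrivial on some `k` in the common kernel of the `χᵢ` keeps the joint map surjective
(correct the last coordinate by a power of `k`). [cite: RibesZalesskii2010, §4.2] -/
theorem surjective_snoc_of_apply_ne_one {n : ℕ} (χ : Fin n → (G →* Multiplicative (ZMod p)))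
    (hsurj : Function.Surjective fun g : G => fun i : Fin n => Multiplicative.toAdd (χ i g))
    (ψ : G →* Multiplicative (ZMod p)) {k : G} (hk : ∀ i, χ i k = 1) (hψk : ψ k ≠ 1) :
    Function.Surjective fun g : G => fun i : Fin (n + 1) =>
      Multiplicative.toAdd ((Fin.snoc χ ψ : Fin (n + 1) → (G →* Multiplicative (ZMod p))) i g) := by
  intro w
  obtain ⟨g, hg⟩ := hsurj fun i => w (Fin.castSucc i)
  set d : ZMod p := Multiplicative.toAdd (ψ k) with hd_def
  have hd : d ≠ 0 := by
    intro h
    apply hψk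
    have : Multiplicative.toAdd (ψ k) = Multiplicative.toAdd (1 : Multiplicative (ZMod p)) := by
      rw [← hd_def, h, toAdd_one]
    exact Multiplicative.toAdd.injective this
  set c : ZMod p := w (Fin.last n) - Multiplicative.toAdd (ψ g) with hc_def
  refine ⟨g * k ^ (c * d⁻¹).val, ?_⟩
  funext i
  refine Fin.lastCases ?_ (fun j => ?_) i
  · simp only [Fin.snoc_last, map_mul, map_pow, toAdd_mul, toAdd_pow]
    rw [← hd_def, nsmul_eq_mul, ZMod.natCast_zmod_val, inv_mul_cancel_right₀ hd, hc_def]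
    abel
  · simp only [Fin.snoc_castSucc, map_mul, map_pow, hk j, one_pow, mul_one]
    exact congr_fun hg j

/-- **The recursion**: a compact (indeed any topological) group with infinitely many open-kernel
characters to `ℤ/p` carries a SEQUENCE of open-kernel characters `χ₀, χ₁, …` all of whose prefixes
`(χ₀, …, χₙ₋₁) : G → (ℤ/p)ⁿ` are surjective. [cite: RibesZalesskii2010, §4.2] -/
theorem exists_seq_characters_prefix_surjective
    (hinf : Set.Infinite {ψ : G →* Multiplicative (ZMod p) | IsOpen (ψ.ker : Set G)}) :
    ∃ χ : ℕ → (G →* Multiplicative (ZMod p)), (∀ i, IsOpen ((χ i).ker : Set G)) ∧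
      ∀ n, Function.Surjective fun g : G => fun i : Fin n => Multiplicative.toAdd (χ i g) := by
  classical
  -- good tuples of length `n`
  let T : ℕ → Type u := fun n =>
    {χ : Fin n → (G →* Multiplicative (ZMod p)) //
      (∀ i, IsOpen ((χ i).ker : Set G)) ∧
        Function.Surjective fun g : G => fun i : Fin n => Multiplicative.toAdd (χ i g)}
  have t0 : T 0 := ⟨Fin.elim0, fun i => Fin.elim0 i, fun w => ⟨1, Subsingleton.elim _ _⟩⟩
  have step : ∀ n (t : T n), ∃ t' : T (n + 1), ∀ i : Fin n, t'.1 (Fin.castSucc i) = t.1 i := by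
    intro n t
    obtain ⟨ψ, hψ, k, hk, hψk⟩ := exists_character_apply_ne_one t.1 t.2.2 hinf
    refine ⟨⟨Fin.snoc t.1 ψ, fun i => ?_, surjective_snoc_of_apply_ne_one t.1 t.2.2 ψ hk hψk⟩,
      fun i => ?_⟩
    · refine Fin.lastCases ?_ (fun j => ?_) i
      · simpa only [Fin.snoc_last] using hψ
      · simpa only [Fin.snoc_castSucc] using t.2.1 j
    · exact Fin.snoc_castSucc (α := fun _ => G →* Multiplicative (ZMod p)) _ _ _
  choose next hnext using step
  let tup : (n : ℕ) → T n := fun n => Nat.rec t0 (fun n t => next n t) n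
  have htup : ∀ n, tup (n + 1) = next n (tup n) := fun n => rfl
  refine ⟨fun i => (tup (i + 1)).1 (Fin.last i), fun i => ?_, fun n => ?_⟩
  · exact (tup (i + 1)).2.1 (Fin.last i)
  · -- the `n`-prefix of the sequence IS `tup n`
    have hpre : ∀ (m i : ℕ) (hi : i < m), (tup m).1 ⟨i, hi⟩ = (tup (i + 1)).1 (Fin.last i) := by
      intro m
      induction m with
      | zero => exact fun i hi => absurd hi (Nat.not_lt_zero i)
      | succ m ih =>
        intro i hi
        by_cases him : i < m
        · rw [htup, ← ih i him]
          exact hnext m (tup m) ⟨i, him⟩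
        · obtain rfl : i = m := by omega
          rfl
    have : (fun g : G => fun i : Fin n => Multiplicative.toAdd ((tup (i + 1)).1 (Fin.last i) g)) =
        fun g : G => fun i : Fin n => Multiplicative.toAdd ((tup n).1 i g) := by
      funext g i
      rw [← hpre n i i.2]
    rw [this]
    exact (tup n).2.2

end Step

/-! ### The surjection onto `(ℤ/p)^ℕ` -/

section Surjection

variable {p : ℕ} [Fact p.Prime]

/-- **A compact group with infinitely many open-kernel characters to `ℤ/p` maps continuously ONTO
`(ℤ/p)^ℕ`** (product of the discrete topologies, written `Multiplicative (ℕ → ZMod p)` as in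
`ProductZModNotStronglyComplete.lean`): with `χ₀, χ₁, …` as in
`exists_seq_characters_prefix_surjective`, the map `g ↦ (χᵢ g)ᵢ` is a continuous homomorphism whose
image is compact, hence closed, and dense (every cylinder on finitely many coordinates is hit), hence
everything. [cite: RibesZalesskii2010, §4.2] -/
theorem exists_continuous_surjective_pi_zmod_of_infinite [IsTopologicalGroup G] [CompactSpace G]
    [TopologicalSpace (ZMod p)] [DiscreteTopology (ZMod p)]
    (hinf : Set.Infinite {ψ : G →* Multiplicative (ZMod p) | IsOpen (ψ.ker : Set G)}) :
    ∃ π : G →* Multiplicative (ℕ → ZMod p), Continuous π ∧ Function.Surjective π := by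
  obtain ⟨χ, hχo, hχs⟩ := exists_seq_characters_prefix_surjective hinf
  -- the joint map as a plain function into the product
  let F : G → (ℕ → ZMod p) := fun g i => Multiplicative.toAdd (χ i g)
  have hFc : Continuous F :=
    continuous_pi fun i => continuous_toAdd.comp (continuous_of_isOpen_ker (χ i) (hχo i))
  have hFs : Function.Surjective F := by
    intro y
    -- `gₙ` hits `y` on the first `n` coordinates
    have hg : ∀ n : ℕ, ∃ g : G, ∀ i : Fin n, F g i = y i := by
      intro n
      obtain ⟨g, hg⟩ := hχs n fun i => y i
      exact ⟨g, fun i => congr_fun hg i⟩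
    choose g hg using hg
    have hT : Tendsto (fun n => F (g n)) atTop (𝓝 y) := by
      refine tendsto_pi_nhds.2 fun i => ?_
      refine (tendsto_const_nhds (x := y i)).congr' ?_
      refine Filter.eventually_atTop.2 ⟨i + 1, fun n hn => ?_⟩
      exact (hg n ⟨i, by omega⟩).symm
    have hmem : y ∈ closure (Set.range F) :=
      mem_closure_of_tendsto hT (Eventually.of_forall fun n => Set.mem_range_self _)
    rwa [(isCompact_range hFc).isClosed.closure_eq] at hmem
  have hFmul : ∀ a b : G, F (a * b) = F a + F b := by
    intro a b
    funext i
    simp [F, toAdd_mul]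
  refine ⟨MonoidHom.mk' (fun g => Multiplicative.ofAdd (F g)) fun a b => ?_, ?_, ?_⟩
  · rw [hFmul, ofAdd_add]
  · exact continuous_ofAdd.comp hFc
  · intro y
    obtain ⟨g, hg⟩ := hFs (Multiplicative.toAdd y)
    exact ⟨g, by simp only [MonoidHom.mk'_apply, hg, ofAdd_toAdd]⟩

/-- **Hence such a group is not strongly complete**: a compact group with infinitely many open-kernel
characters to `ℤ/p` has a subgroup of finite index which is NOT open (the preimage of a non-open
index-`p` subgroup of `(ℤ/p)^ℕ`, `ProductZModNotStronglyComplete.lean`).  E.g. a free pro-`p` group of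
infinite rank, such as the wild inertia group of a `p`-adic local field.
[cite: RibesZalesskii2010, §4.2] -/
theorem exists_finiteIndex_not_isOpen_of_infinite_characters [IsTopologicalGroup G] [CompactSpace G]
    (hinf : Set.Infinite {ψ : G →* Multiplicative (ZMod p) | IsOpen (ψ.ker : Set G)}) :
    ∃ V : Subgroup G, V.FiniteIndex ∧ ¬ IsOpen (V : Set G) := by
  letI : TopologicalSpace (ZMod p) := ⊥
  haveI : DiscreteTopology (ZMod p) := ⟨rfl⟩
  haveI : IsTopologicalAddGroup (ZMod p) :=
    { continuous_add := continuous_of_discreteTopology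
      continuous_neg := continuous_of_discreteTopology }
  haveI : Finite (ZMod p) := Finite.of_fintype _
  haveI : T2Space (Multiplicative (ℕ → ZMod p)) := inferInstanceAs (T2Space (ℕ → ZMod p))
  obtain ⟨π, hπ, hsurj⟩ := exists_continuous_surjective_pi_zmod_of_infinite (p := p) hinf
  exact exists_finiteIndex_not_isOpen_of_surjective π hπ hsurj (exists_finiteIndex_not_isOpen_pi (ZMod p))

/-- **Contrapositive — strongly complete compact groups have finitely many characters to `ℤ/p`**: if
every finite-index subgroup of the compact group `G` is open, then `G` has only finitely many
homomorphisms `G →* ℤ/p` (all of them then have open kernel, of index `1` or `p`).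
[cite: RibesZalesskii2010, §4.2] -/
theorem finite_characters_of_forall_finiteIndex_isOpen [IsTopologicalGroup G] [CompactSpace G]
    (h : ∀ V : Subgroup G, V.FiniteIndex → IsOpen (V : Set G)) :
    Set.Finite (Set.univ : Set (G →* Multiplicative (ZMod p))) := by
  by_contra hinf
  have hker : ∀ ψ : G →* Multiplicative (ZMod p), IsOpen (ψ.ker : Set G) := by
    intro ψ
    refine h _ ⟨?_⟩
    rw [Subgroup.index_ker]
    exact Nat.card_pos.ne'
  have : Set.Infinite {ψ : G →* Multiplicative (ZMod p) | IsOpen (ψ.ker : Set G)} := by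
    have e : {ψ : G →* Multiplicative (ZMod p) | IsOpen (ψ.ker : Set G)} = Set.univ :=
      Set.eq_univ_of_forall fun ψ => hker ψ
    rw [e]
    exact hinf
  obtain ⟨V, hV, hVo⟩ := exists_finiteIndex_not_isOpen_of_infinite_characters (p := p) this
  exact hVo (h V hV)

end Surjection

/-! ### In the language of open normal subgroups of index `p` -/

section IndexP

variable {p : ℕ} [Fact p.Prime]

omit [TopologicalSpace G] in
/-- An open normal subgroup of index `p` is the kernel of a homomorphism onto `ℤ/p` with open kernel
(`G ⧸ N` is cyclic of prime order).  Private plumbing. [folklore] -/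
private theorem exists_character_ker_eq_of_index_eq (N : Subgroup G) [N.Normal] (hN : N.index = p) :
    ∃ ψ : G →* Multiplicative (ZMod p), ψ.ker = N := by
  haveI : Fact (Nat.card (G ⧸ N)).Prime := by rw [← Subgroup.index]; rw [hN]; infer_instance
  haveI hc : IsCyclic (G ⧸ N) := isCyclic_of_prime_card (p := Nat.card (G ⧸ N)) rfl
  have hcard : Nat.card (G ⧸ N) = Nat.card (Multiplicative (ZMod p)) := by
    rw [← Subgroup.index, hN, Nat.card_eq_fintype_card]
    simp
  let e : G ⧸ N ≃* Multiplicative (ZMod p) := mulEquivOfCyclicCardEq hcard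
  refine ⟨e.toMonoidHom.comp (QuotientGroup.mk' N), ?_⟩
  ext g
  simp only [MonoidHom.mem_ker, MonoidHom.coe_comp, MulEquiv.coe_toMonoidHom, Function.comp_apply,
    QuotientGroup.mk'_apply, EmbeddingLike.map_eq_one_iff, QuotientGroup.eq_one_iff]

/-- **Infinitely many open normal subgroups of index `p` ⟹ not strongly complete** (compact `G`):
there is a finite-index subgroup that is not open.  For a pro-`p` group `P` the open normal subgroups
of index `p` are the hyperplanes of the `𝔽_p`-vector space `P/Φ(P)`, so the hypothesis reads «`P` is
not topologically finitely generated» — the converse boundary of Serre's theorem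
(`Literature.GroupTheory.ProP.isOpen_of_finiteIndex_of_proP`). [cite: RibesZalesskii2010, §4.2] -/
theorem exists_finiteIndex_not_isOpen_of_infinite_openNormal_index_eq [IsTopologicalGroup G]
    [CompactSpace G]
    (hinf : Set.Infinite {N : Subgroup G | N.Normal ∧ IsOpen (N : Set G) ∧ N.index = p}) :
    ∃ V : Subgroup G, V.FiniteIndex ∧ ¬ IsOpen (V : Set G) := by
  classical
  refine exists_finiteIndex_not_isOpen_of_infinite_characters (p := p) ?_
  -- `N ↦ ψ_N` (a character with kernel `N`) is injective
  have hch : ∀ N : {N : Subgroup G | N.Normal ∧ IsOpen (N : Set G) ∧ N.index = p},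
      ∃ ψ : G →* Multiplicative (ZMod p), ψ.ker = N.1 := by
    rintro ⟨N, hNn, -, hNi⟩
    haveI := hNn
    exact exists_character_ker_eq_of_index_eq N hNi
  choose ψ hψ using hch
  have hinj : Function.Injective ψ := by
    intro N N' he
    apply Subtype.ext
    rw [← hψ N, ← hψ N', he]
  haveI : Infinite {N : Subgroup G | N.Normal ∧ IsOpen (N : Set G) ∧ N.index = p} :=
    hinf.to_subtype
  have hrange : Set.Infinite (Set.range ψ) := Set.infinite_range_of_injective hinj
  refine hrange.mono ?_
  rintro _ ⟨N, rfl⟩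
  change IsOpen ((ψ N).ker : Set G)
  rw [hψ N]
  exact N.2.2.1

/-- **Contrapositive**: a strongly complete compact group has only finitely many open normal
subgroups of index `p`, for every prime `p`. [cite: RibesZalesskii2010, §4.2] -/
theorem finite_openNormal_index_eq_of_forall_finiteIndex_isOpen [IsTopologicalGroup G]
    [CompactSpace G] (h : ∀ V : Subgroup G, V.FiniteIndex → IsOpen (V : Set G)) :
    Set.Finite {N : Subgroup G | N.Normal ∧ IsOpen (N : Set G) ∧ N.index = p} := by
  by_contra hinf
  obtain ⟨V, hV, hVo⟩ := exists_finiteIndex_not_isOpen_of_infinite_openNormal_index_eq (p := p) hinf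
  exact hVo (h V hV)

end IndexP

end Literature.GroupTheory
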